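import Summits.Langlands.Langlands.Theorems.QuadraticWindowHostInducedRepMemberSign
import Summits.Langlands.Langlands.Theorems.QuadraticWindowHostInducedRepPatchDescend
import Literature.NumberTheory.Automorphic.QuadraticCharacterTwist
import Literature.NumberTheory.GaloisRepresentations.ArtinCharacterReciprocityArchimedean
import Literature.NumberTheory.GaloisRepresentations.ArtinCharacterReciprocityProofs
import Literature.NumberTheory.GaloisRepresentations.AbsGaloisOuterConj
import Literature.NumberTheory.QuadraticForms.QuadraticExtensionPlaces

/-!
# The parity step — sub-stub `stub_memberParity` of the member statement `pkg_member` (stub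
# `stub_package`, line `one-transparent-pane`, item stmt-Langlands-10902, crux
# `Summit.Langlands.Langlands.Theses.QuadraticWindow.HostInducedRep`)

LOG (wave-3 worker `stub_memberParity`, 2026-08-16): PROVED, rc 0, 0 warnings, 0 sorries, standard
axioms; the registered signature follows `theorem stub_memberParity :` verbatim (last declaration);
predicates `ParityOut`, `MuHyp` from `…HostInducedRepPaneDefs.lean`; one named fact in front
(`artinReciprocity_character_archimedean`, Literature, landed); finite-place class field theory is
the PROVED `artinReciprocity_character_holds`.

Statement.  For the crux data with `Hyps τ n π e k ℓ eψ` (`F₀` totally real, `F/F₀` quadratic of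
involution `τ`, parity hypotheses `hpar`, `hψpar`), a CM quadratic `K/F₀`, the Artin avatars `χe, ω`
of `e, eψ` and `ω₀ = ω|_{𝔸_{F₀}}`: `ParityOut F K (χe ω₀)` — the real components `θ_v(-1)` of
`θ = χe ω₀` agree below any two real places of `F`, and `μK = ω_{K/F₀}`, `μF = ω_{F/F₀}` are
admissible (`MuHyp`, also `μK μF`) with `μK,v(-1) = -1` everywhere and `μF,v(-1) = -1` exactly
below the complex places of `F`.

Proof.  §1 the restriction `Γ_F → Γ_{F₀}` of a complex conjugation for `φ` is one for `φ|_{F₀}`; a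
complex conjugation at `v` in the image of `Γ_M` forces a REAL place of `M` above `v`; `det χ_{M/F₀}
= -1` off the image.  §2 the fibre of `w|_{F₀}` is `{w, τ w}`, `τ w ≠ w` for `w` real, with real
embeddings `φ_w|_{F₀}`, `φ_w ∘ τ`.  §3 `ideleBaseChange ((-1)_v) = (-1)_w (-1)_{τw}`.  §4 `θ_v(-1) =
χe,v(-1) ω₀,v(-1) = det e(res c_w) · det eψ(c_w) det eψ(c_{τw})` (archimedean reciprocity, three
times) `= det e(res c_w) ω_w(-1)² = det (e|_{Γ_F})(c_w)` (`hψpar`), constant by `hpar`.  §5 `μK, μF`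
:= the Hecke characters of `χ_{K/F₀}`, `χ_{F/F₀}` (`artinReciprocity_character_holds`); a.e.
`μ(ϖ_v) = ε(v) = ±1`, `= 1` at split `v` (Frobenius dictionary of `quadraticArtinChar`); real
components by archimedean reciprocity (`χ_{K/F₀}(c_v) = -1` as `K` is totally complex;
`χ_{F/F₀}(res c_w) = 1` for `w` real; `χ_{F/F₀}(c_v) = -1` if the places above `v` are complex).
-/

open scoped BigOperators Polynomial Classical
open Filter Set Polynomial IsDedekindDomain NumberField
open Literature.NumberTheory.Automorphic Literature.NumberTheory.GaloisRepresentations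
open Literature.NumberTheory.QuadraticForms
open Summit.Langlands.Langlands.Theorems.HostInducedRep.GrsExplicitDescent

-- `Summit.Langlands.Langlands.…` (summit = sub-problem name, D-0017 layout) trips `dupNamespace`.
set_option linter.dupNamespace false

noncomputable section

namespace Summit.Langlands.Langlands.Theorems.HostInducedRep.OneTransparentPane

section GaloisSide

variable {F₀ M : Type} [Field F₀] [Field M] [Algebra F₀ M]

/-- **Restriction of complex conjugations**: if `c ∈ Γ_M` is a complex conjugation for the real
embedding `φ` of `M`, then its restriction `res c ∈ Γ_{F₀}` (`absGaloisRestrict`) is a complex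
conjugation for `φ|_{F₀}` (the embedding `F̄₀ → M̄ → ℂ`). [folklore] -/
theorem isComplexConjugation_absGaloisRestrict {φ : M →+* ℝ} {c : Field.absoluteGaloisGroup M}
    (hc : IsComplexConjugation φ c) :
    IsComplexConjugation (φ.comp (algebraMap F₀ M)) (absGaloisRestrict F₀ M c) := by
  rw [isComplexConjugation_iff] at hc ⊢
  obtain ⟨ι, hι, hιc⟩ := hc
  refine ⟨ι.comp (absClosureEmbedding F₀ M : AlgebraicClosure F₀ →+* AlgebraicClosure M), ?_,
    fun x ↦ ?_⟩
  · ext x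
    have h1 := RingHom.congr_fun hι (algebraMap F₀ M x)
    simp only [RingHom.comp_apply] at h1 ⊢
    rw [← h1, RingHom.coe_coe, AlgHom.commutes, IsScalarTower.algebraMap_apply F₀ M]
  · simp only [RingHom.comp_apply, RingHom.coe_coe]
    rw [absGaloisRestrict_apply_smul]
    exact hιc _

/-- **A complex conjugation at `v` in the image of `Γ_M` sees a real place of `M` above `v`**: such
a `c` fixes the copy `e(M) ⊆ F̄₀` of `M` (`mem_range_absGaloisRestrict_iff_smul_absEmbedding`), so
the embedding `ι ∘ e` of `M` (`ι : F̄₀ → ℂ` realising `c` as complex conjugation) is real.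
[folklore] -/
theorem exists_isReal_comap_of_mem_range [Algebra.IsAlgebraic F₀ M] {v : InfinitePlace F₀}
    (hv : v.IsReal) {c : Field.absoluteGaloisGroup F₀} (hc : IsComplexConjugationAt hv c)
    (hmem : c ∈ (absGaloisRestrict F₀ M).range) :
    ∃ w : InfinitePlace M, w.IsReal ∧ w.comap (algebraMap F₀ M) = v := by
  rw [isComplexConjugationAt_iff] at hc
  obtain ⟨ι, hι, hιc⟩ := hc
  rw [mem_range_absGaloisRestrict_iff_smul_absEmbedding] at hmem
  let ψ : M →+* ℂ := ι.comp (absEmbedding F₀ M : M →+* AlgebraicClosure F₀)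
  have hψ : ComplexEmbedding.IsReal ψ := by
    rw [ComplexEmbedding.isReal_iff]
    ext1 x
    change star (ι (absEmbedding F₀ M x)) = ι (absEmbedding F₀ M x)
    rw [← hιc.eq]
    exact congrArg ι (hmem x)
  refine ⟨InfinitePlace.mk ψ, ⟨ψ, hψ, rfl⟩, ?_⟩
  rw [InfinitePlace.comap_mk, ← InfinitePlace.mk_embedding v, ← hι.over]
  congr 1
  ext1 x
  change ι (absEmbedding F₀ M (algebraMap F₀ M x)) = ι (algebraMap F₀ (AlgebraicClosure F₀) x)
  rw [AlgHom.commutes]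

/-- `det χ_{M/F₀}(g) = -1` for `g ∉ res(Γ_M)` (the `1 × 1` matrix `χ_{M/F₀}(g)` has entry `-1`).
[folklore] -/
theorem det_quadraticArtinChar_of_not_mem [NumberField F₀] [NumberField M]
    (h2 : Module.finrank F₀ M = 2) {g : Field.absoluteGaloisGroup F₀}
    (hg : g ∉ (absGaloisRestrict F₀ M).range) :
    Matrix.GeneralLinearGroup.det (quadraticArtinChar F₀ M h2 g) = -1 := by
  ext
  rw [Matrix.GeneralLinearGroup.val_det_apply, Matrix.det_fin_one,
    quadraticArtinChar_apply_coe_of_not_mem h2 hg, Units.val_neg, Units.val_one]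

variable [NumberField F₀] [NumberField M]

/-- **`μ(ϖ_v) = ε_{M/F₀}(v)` almost everywhere** for the Hecke character `μ` attached to
`χ_{M/F₀}` by reciprocity at the finite places (`eventually_hasFrobCharpolyAt_quadraticArtinChar`
and uniqueness of Frobenius characteristic polynomials). [folklore] -/
theorem eventually_valueAtUniformizer_eq_quadraticSign (h2 : Module.finrank F₀ M = 2)
    {μ : HeckeCharacter F₀}
    (hμ : ∀ v : HeightOneSpectrum (𝓞 F₀), (quadraticArtinChar F₀ M h2).IsUnramifiedAt v →
      μ.IsUnramifiedAt v ∧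
        (quadraticArtinChar F₀ M h2).HasFrobCharpolyAt v (X - C (μ.valueAtUniformizer v))) :
    ∀ᶠ v : HeightOneSpectrum (𝓞 F₀) in cofinite,
      μ.IsUnramifiedAt v ∧ μ.valueAtUniformizer v = quadraticSign M v := by
  -- adapted from Literature/NumberTheory/Automorphic/QuadraticCharacterTwist.lean
  filter_upwards [eventually_hasFrobCharpolyAt_quadraticArtinChar h2] with v hv
  refine ⟨(hμ v hv.1).1, ?_⟩
  have h := hasFrobCharpolyAt_unique (hμ v hv.1).2 hv.2
  simpa using h

/-- **`ε_{M/F₀}(v) = 1` at a place split in `M`** (`[M:F₀]` primes above `v`: every place above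
`v` has residue degree `1`, `ramificationIdx_inertiaDeg_eq_one_of_ncard`). [folklore] -/
theorem quadraticSign_eq_one_of_ncard [IsGalois F₀ M] (h2 : Module.finrank F₀ M = 2)
    {v : HeightOneSpectrum (𝓞 F₀)} (h : (v.asIdeal.primesOver (𝓞 M)).ncard = 2) :
    quadraticSign M v = 1 := by
  obtain ⟨u, hu⟩ := exists_under_eq (K := M) v
  have hf := (ramificationIdx_inertiaDeg_eq_one_of_ncard v (h.trans h2.symm) u hu).2
  unfold quadraticSign
  rw [if_pos ⟨u, congrArg HeightOneSpectrum.asIdeal hu, hf⟩]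

/-- `χ ψ` is unramified where `χ` and `ψ` are. [folklore] -/
theorem parity_isUnramifiedAt_mul {χ ψ : HeckeCharacter F₀} {v : HeightOneSpectrum (𝓞 F₀)}
    (hχ : χ.IsUnramifiedAt v) (hψ : ψ.IsUnramifiedAt v) : (χ * ψ).IsUnramifiedAt v := fun u ↦ by
  -- adapted from Summits/…/PicardMuOrdinaryResidualAutomorphyEvenHeckeAlgebra.lean
  have h1 := hχ u
  have h2 := hψ u
  rw [HeckeCharacter.localComponent_apply] at h1 h2 ⊢
  rw [HeckeCharacter.mul_apply, h1, h2, mul_one]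

/-- `(χ ψ)(ϖ_v) = χ(ϖ_v) ψ(ϖ_v)`. [folklore] -/
theorem parity_valueAtUniformizer_mul (χ ψ : HeckeCharacter F₀) (v : HeightOneSpectrum (𝓞 F₀)) :
    (χ * ψ).valueAtUniformizer v = χ.valueAtUniformizer v * ψ.valueAtUniformizer v := by
  -- adapted from Summits/Langlands/Langlands/Theorems/QuadraticWindowHostInducedRepPackageDict.lean
  simp only [HeckeCharacter.valueAtUniformizer, HeckeCharacter.localComponent_apply,
    HeckeCharacter.mul_apply, Units.val_mul]

/-- **Admissibility of the quadratic Hecke characters**: a finite-order `μ` with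
`μ(ϖ_v) = ε_{M/F₀}(v)` a.e. satisfies the a.e. clause of `MuHyp` relative to `M` in EITHER slot
(`ε² = 1`, `ε = 1` at places split in `M`). [folklore] -/
theorem eventually_muHyp_clause [IsGalois F₀ M] (h2 : Module.finrank F₀ M = 2)
    {μ : HeckeCharacter F₀}
    (hae : ∀ᶠ v : HeightOneSpectrum (𝓞 F₀) in cofinite,
      μ.IsUnramifiedAt v ∧ μ.valueAtUniformizer v = quadraticSign M v) :
    ∀ᶠ v : HeightOneSpectrum (𝓞 F₀) in cofinite,
      μ.IsUnramifiedAt v ∧ μ.valueAtUniformizer v ^ 2 = 1 ∧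
        ((v.asIdeal.primesOver (𝓞 M)).ncard = 2 → μ.valueAtUniformizer v = 1) := by
  filter_upwards [hae] with v hv
  refine ⟨hv.1, by rw [hv.2, sq, quadraticSign_mul_self], fun h ↦ ?_⟩
  rw [hv.2, quadraticSign_eq_one_of_ncard h2 h]

/-- **The real components of `μ_{M/F₀}` below the complex places**: if `v` (real) has no real place
of `M` above it, then `μ_v(-1) = det χ_{M/F₀}(c_v) = -1` (archimedean reciprocity; a complex
conjugation at `v` in `res(Γ_M)` would produce a real place of `M` above `v`). [folklore] -/
theorem archComponent_neg_one_eq_neg_one_of_forall_not_isReal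
    (hCFT : artinReciprocity_character_archimedean) (h2 : Module.finrank F₀ M = 2)
    {μ : HeckeCharacter F₀}
    (hμ : ∀ v : HeightOneSpectrum (𝓞 F₀), (quadraticArtinChar F₀ M h2).IsUnramifiedAt v →
      μ.IsUnramifiedAt v ∧
        (quadraticArtinChar F₀ M h2).HasFrobCharpolyAt v (X - C (μ.valueAtUniformizer v)))
    {v : InfinitePlace F₀} (hv : v.IsReal)
    (hM : ∀ w : InfinitePlace M, w.comap (algebraMap F₀ M) = v → ¬ w.IsReal) :
    μ.archComponent v (-1) = -1 := by
  haveI : Module.Finite F₀ M := Module.finite_of_finrank_eq_succ h2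
  obtain ⟨c, hc⟩ := exists_isComplexConjugation (InfinitePlace.embedding_of_isReal hv)
  rw [hCFT F₀ (quadraticArtinChar F₀ M h2) μ hμ v hv c hc]
  refine det_quadraticArtinChar_of_not_mem h2 fun hmem ↦ ?_
  obtain ⟨w, hw, hwv⟩ := exists_isReal_comap_of_mem_range hv hc hmem
  exact hM w hwv hw

end GaloisSide

section Places

variable {F₀ F : Type} [Field F₀] [Field F] [Algebra F₀ F]

/-- **The fibres of `w ↦ w|_{F₀}`** in the quadratic `F/F₀` with involution `τ`: `w'|_{F₀} =
w|_{F₀}` iff `w' ∈ {w, τ w}` (Mathlib `exists_smul_eq_of_comap_eq`, `mem_orbit_iff`). [folklore] -/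
theorem comap_eq_comap_iff [NumberField F₀] [Algebra.IsQuadraticExtension F₀ F] {τ : F ≃ₐ[F₀] F}
    (hτ : τ ≠ 1) {w w' : InfinitePlace F} :
    w'.comap (algebraMap F₀ F) = w.comap (algebraMap F₀ F) ↔ w' = w ∨ w' = τ • w := by
  constructor
  · intro h
    obtain ⟨σ, rfl⟩ := InfinitePlace.exists_smul_eq_of_comap_eq h.symm
    rcases QuadraticExtension.algEquiv_eq_one_or_eq hτ σ with rfl | rfl
    · exact Or.inl (one_smul _ _)
    · exact Or.inr rfl
  · rintro (rfl | rfl)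
    · rfl
    · exact (InfinitePlace.mem_orbit_iff.mp ⟨τ, rfl⟩).symm

/-- A real place is moved by the involution: `τ w ≠ w` (a real place is unramified, so its
stabiliser in `Gal(F/F₀)` is trivial). [folklore] -/
theorem smul_ne_self_of_isReal {τ : F ≃ₐ[F₀] F} (hτ : τ ≠ 1) {w : InfinitePlace F}
    (hw : w.IsReal) : τ • w ≠ w := by
  intro h
  have hmem : τ ∈ MulAction.stabilizer (F ≃ₐ[F₀] F) w := h
  rw [(InfinitePlace.IsReal.isUnramified F₀ hw).stabilizer_eq_bot, Subgroup.mem_bot] at hmem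
  exact hτ hmem

/-- The real embedding of `w|_{F₀}` is `φ_w|_{F₀}` (`w` real). [folklore] -/
theorem embedding_of_isReal_comap {w : InfinitePlace F} (hw : w.IsReal)
    (hv : (w.comap (algebraMap F₀ F)).IsReal) :
    InfinitePlace.embedding_of_isReal hv =
      (InfinitePlace.embedding_of_isReal hw).comp (algebraMap F₀ F) := by
  ext x
  apply Complex.ofReal_injective
  have h := RingHom.congr_fun (InfinitePlace.comap_embedding_of_isReal (algebraMap F₀ F) hv) x
  rw [InfinitePlace.embedding_of_isReal_apply, h, RingHom.comp_apply, RingHom.comp_apply,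
    InfinitePlace.embedding_of_isReal_apply]

/-- The real embedding of `τ w` is `φ_w ∘ τ` (`w` real, `τ` the involution). [folklore] -/
theorem embedding_of_isReal_smul [NumberField F₀] [Algebra.IsQuadraticExtension F₀ F]
    {τ : F ≃ₐ[F₀] F} (hτ : τ ≠ 1) {w : InfinitePlace F} (hw : w.IsReal) (hw' : (τ • w).IsReal) :
    InfinitePlace.embedding_of_isReal hw' =
      (InfinitePlace.embedding_of_isReal hw).comp (τ : F →+* F) := by
  ext x
  apply Complex.ofReal_injective
  have h := RingHom.congr_fun
    (InfinitePlace.comap_embedding_of_isReal (w := w) ((τ.symm : F ≃ₐ[F₀] F) : F →+* F) hw') x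
  change ((InfinitePlace.embedding_of_isReal hw' x : ℝ) : ℂ) =
    ((InfinitePlace.embedding_of_isReal hw (τ x) : ℝ) : ℂ)
  rw [InfinitePlace.embedding_of_isReal_apply, InfinitePlace.embedding_of_isReal_apply]
  refine h.trans ?_
  change w.embedding (τ.symm x) = w.embedding (τ x)
  congr 1
  rw [AlgEquiv.symm_apply_eq]
  exact (QuadraticExtension.algEquiv_algEquiv_apply hτ x).symm

end Places

section Ideles

variable {F₀ F : Type} [Field F₀] [NumberField F₀] [Field F] [NumberField F] [Algebra F₀ F]

/-- The `v'`-component of the idele `(-1)_v` is `-1` at `v' = v` (a dependent-type bookkeeping form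
of `infiniteIdeleSingle_fst_self`). [folklore] -/
theorem infiniteIdeleSingle_neg_one_fst_of_eq {v v' : InfinitePlace F₀} (h : v' = v) :
    ((infiniteIdeleSingle v (-1) : ideleGroup F₀) : AdeleRing (𝓞 F₀) F₀).1 v' = -1 := by
  subst h
  rw [infiniteIdeleSingle_fst_self, Units.val_neg, Units.val_one]

/-- **Base change of the idele `(-1)_v`** along the quadratic `F/F₀`: for `v = w|_{F₀}` with
`τ w ≠ w`, `ideleBaseChange F₀ F ((-1)_v) = (-1)_w (-1)_{τ w}` (the fibre of `v` is `{w, τ w}`;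
`InfiniteAdeleRing.baseChange_apply`). [folklore] -/
theorem ideleBaseChange_infiniteIdeleSingle_neg_one [Algebra.IsQuadraticExtension F₀ F]
    {τ : F ≃ₐ[F₀] F} (hτ : τ ≠ 1) {w : InfinitePlace F} (hw : τ • w ≠ w) :
    AdeleRing.ideleBaseChange F₀ F (infiniteIdeleSingle (w.comap (algebraMap F₀ F)) (-1)) =
      infiniteIdeleSingle w (-1) * infiniteIdeleSingle (τ • w) (-1) := by
  apply Units.ext
  refine Prod.ext ?_ ?_
  · funext w'
    change infiniteCompletionOfComap F₀ F w'
        (((infiniteIdeleSingle (w.comap (algebraMap F₀ F)) (-1) : ideleGroup F₀) :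
          AdeleRing (𝓞 F₀) F₀).1 (w'.comap (algebraMap F₀ F))) =
      ((infiniteIdeleSingle w (-1) : ideleGroup F) : AdeleRing (𝓞 F) F).1 w' *
        ((infiniteIdeleSingle (τ • w) (-1) : ideleGroup F) : AdeleRing (𝓞 F) F).1 w'
    by_cases h : w'.comap (algebraMap F₀ F) = w.comap (algebraMap F₀ F)
    · rw [infiniteIdeleSingle_neg_one_fst_of_eq h, map_neg, map_one]
      rcases (comap_eq_comap_iff hτ).mp h with rfl | rfl
      · rw [infiniteIdeleSingle_fst_self, infiniteIdeleSingle_fst_of_ne _ hw.symm, Units.val_neg,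
          Units.val_one, mul_one]
      · rw [infiniteIdeleSingle_fst_self, infiniteIdeleSingle_fst_of_ne _ hw, Units.val_neg,
          Units.val_one, one_mul]
    · have h1 : w' ≠ w := fun e ↦ h (by rw [e])
      have h2 : w' ≠ τ • w := fun e ↦ h ((comap_eq_comap_iff hτ).mpr (Or.inr e))
      rw [infiniteIdeleSingle_fst_of_ne _ h, map_one, infiniteIdeleSingle_fst_of_ne _ h1,
        infiniteIdeleSingle_fst_of_ne _ h2, mul_one]
  · change FiniteAdeleRing.baseChange (𝓞 F₀) F₀ F (𝓞 F)
        (((infiniteIdeleSingle (w.comap (algebraMap F₀ F)) (-1) : ideleGroup F₀) :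
          AdeleRing (𝓞 F₀) F₀).2) =
      ((infiniteIdeleSingle w (-1) : ideleGroup F) : AdeleRing (𝓞 F) F).2 *
        ((infiniteIdeleSingle (τ • w) (-1) : ideleGroup F) : AdeleRing (𝓞 F) F).2
    rw [infiniteIdeleSingle_snd, infiniteIdeleSingle_snd, infiniteIdeleSingle_snd, map_one, mul_one]

/-- **`θ_v(-1) = det (e|_{Γ_F})(c_w)`** for `v = w|_{F₀}` below the REAL place `w` of `F` and a
complex conjugation `c_w ∈ Γ_F` at `w`: `χe,v(-1) = det e(res c_w)` and `ω₀,v(-1) =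
ω((-1)_w (-1)_{τw}) = det eψ(c_w) det eψ(c_{τw}) = ω_w(-1)² = 1` (archimedean reciprocity, `hψpar`).
[folklore] -/
theorem theta_archComponent_eq (hCFT : artinReciprocity_character_archimedean)
    [Algebra.IsQuadraticExtension F₀ F] {τ : F ≃ₐ[F₀] F} (hτ : τ ≠ 1)
    {e : FramedGaloisRep F₀ ℂ 1} {eψ : FramedGaloisRep F ℂ 1}
    (hψpar : ∀ (φ : F →+* ℝ) (c c' : Field.absoluteGaloisGroup F), IsComplexConjugation φ c →
      IsComplexConjugation (φ.comp (τ : F →+* F)) c' →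
      Matrix.GeneralLinearGroup.det (eψ c) = Matrix.GeneralLinearGroup.det (eψ c'))
    {χe : HeckeCharacter F₀} {ω : HeckeCharacter F} {ω₀ : HeckeCharacter F₀}
    (hχe : ∀ v : HeightOneSpectrum (𝓞 F₀), e.IsUnramifiedAt v →
      χe.IsUnramifiedAt v ∧ e.HasFrobCharpolyAt v (X - C (χe.valueAtUniformizer v)))
    (hω : ∀ w : HeightOneSpectrum (𝓞 F), eψ.IsUnramifiedAt w →
      ω.IsUnramifiedAt w ∧ eψ.HasFrobCharpolyAt w (X - C (ω.valueAtUniformizer w)))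
    (hω₀ : ∀ x, ω₀ x = ω (AdeleRing.ideleBaseChange F₀ F x))
    {w : InfinitePlace F} (hw : w.IsReal) {c : Field.absoluteGaloisGroup F}
    (hc : IsComplexConjugationAt hw c) :
    (χe * ω₀).archComponent (w.comap (algebraMap F₀ F)) (-1) =
      Matrix.GeneralLinearGroup.det ((e.restrictField F) c) := by
  have hv : (w.comap (algebraMap F₀ F)).IsReal := hw.comap _
  -- the `χe` factor: reciprocity at `v` for the complex conjugation `res c`
  have h1 : χe.archComponent (w.comap (algebraMap F₀ F)) (-1) =
      Matrix.GeneralLinearGroup.det (e (absGaloisRestrict F₀ F c)) := by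
    refine hCFT F₀ e χe hχe _ hv _ ?_
    change IsComplexConjugation _ _
    rw [embedding_of_isReal_comap hw hv]
    exact isComplexConjugation_absGaloisRestrict hc
  -- the `ω₀` factor: `ω₀,v(-1) = ω_w(-1) ω_{τw}(-1) = ω_w(-1)² = 1`
  have hw' : (τ • w).IsReal := InfinitePlace.isReal_smul_iff.mpr hw
  obtain ⟨c', hc'⟩ := exists_isComplexConjugation (InfinitePlace.embedding_of_isReal hw')
  have h2 : ω.archComponent (τ • w) (-1) = ω.archComponent w (-1) := by
    rw [hCFT F eψ ω hω w hw c hc, hCFT F eψ ω hω (τ • w) hw' c' hc']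
    refine (hψpar (InfinitePlace.embedding_of_isReal hw) c c' hc ?_).symm
    rw [← embedding_of_isReal_smul hτ hw hw']
    exact hc'
  have h3 : ω₀.archComponent (w.comap (algebraMap F₀ F)) (-1) = 1 := by
    rw [HeckeCharacter.archComponent_apply, hω₀,
      ideleBaseChange_infiniteIdeleSingle_neg_one hτ (smul_ne_self_of_isReal hτ hw), map_mul,
      ← HeckeCharacter.archComponent_apply, ← HeckeCharacter.archComponent_apply, h2, ← sq,
      archComponent_neg_one_sq]
  rw [archComponent_mul_apply, h1, h3, mul_one, FramedGaloisRep.restrictField_apply]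

end Ideles

/-- **Sub-stub PARITY (`stub_memberParity`; fact: Artin reciprocity at the real places
`artinReciprocity_character_archimedean`).**  The Galois-side parity hypotheses of the crux read on
the Hecke side: with `θ = χe ω₀`, `θ_v(-1) = det e(res c_w) · ω_w(-1) ω_{τw}(-1) =
det (e|_{Γ_F})(c_w)` below the real places `w, τw` of `F` (`hψpar`), constant by `hpar`; and the
quadratic characters `χ_{K/F₀}`, `χ_{F/F₀}` have finite-order avatars `μK, μF`
(`artinReciprocity_character_holds`) with `μ(ϖ_v) = ±1`, `= 1` at split `v`, `μK,v(-1) = -1` (`K`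
totally complex) and `μF,v(-1) = -1` iff `v` is complex in `F`. [folklore] -/
theorem stub_memberParity : artinReciprocity_character_archimedean → ∀ (F₀ F : Type) [Field F₀] [NumberField F₀] [Field F] [NumberField F] [Algebra F₀ F] (τ : F ≃ₐ[F₀] F) (n : ℕ) (hcpt : isCompact_glFiniteIntegralLevel n F) (π : CuspidalAutomorphicRepData n F hcpt) (e : FramedGaloisRep F₀ ℂ 1) (k : ℤ) (ℓ : ℕ) [Fact ℓ.Prime] (eψ : FramedGaloisRep F ℂ 1), Hyps τ n π e k ℓ eψ → ∀ (K : Type) [Field K] [NumberField K] [Algebra F₀ K] [IsCMField K], Module.finrank F₀ K = 2 → ∀ (χe : HeckeCharacter F₀) (ω : HeckeCharacter F) (ω₀ : HeckeCharacter F₀), (∀ v : HeightOneSpectrum (𝓞 F₀), e.IsUnramifiedAt v → χe.IsUnramifiedAt v ∧ e.HasFrobCharpolyAt v (X - C (χe.valueAtUniformizer v))) → (∀ w : HeightOneSpectrum (𝓞 F), eψ.IsUnramifiedAt w → ω.IsUnramifiedAt w ∧ eψ.HasFrobCharpolyAt w (X - C (ω.valueAtUniformizer w))) → (∀ x, ω₀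 x = ω (AdeleRing.ideleBaseChange F₀ F x)) → ParityOut F K (χe * ω₀) := by
  intro hCFT F₀ F _ _ _ _ _ τ n hcpt π e k ℓ _ eψ hH K _ _ _ _ h2K χe ω ω₀ hχe hω hω₀
  obtain ⟨hTR, hdeg, hτ, -, -, hpar, -, -, -, -, hψpar, -⟩ := hH
  haveI : Algebra.IsQuadraticExtension F₀ F := ⟨hdeg⟩
  haveI : Algebra.IsQuadraticExtension F₀ K := ⟨h2K⟩
  refine ⟨fun w w' hw hw' ↦ ?_, ?_⟩
  · -- constancy of `θ_v(-1)` below the real places of `F`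
    obtain ⟨c, hc⟩ := exists_isComplexConjugation (InfinitePlace.embedding_of_isReal hw)
    obtain ⟨c', hc'⟩ := exists_isComplexConjugation (InfinitePlace.embedding_of_isReal hw')
    rw [theta_archComponent_eq hCFT hτ hψpar hχe hω hω₀ hw hc,
      theta_archComponent_eq hCFT hτ hψpar hχe hω hω₀ hw' hc']
    rcases hpar with hodd | hone
    · rw [hodd _ c hc, hodd _ c' hc']
    · rw [hone _ c hc, hone _ c' hc']
  · -- the quadratic characters
    obtain ⟨μK, hKfin, hμK⟩ := artinReciprocity_character_holds F₀ (quadraticArtinChar F₀ K h2K)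
    obtain ⟨μF, hFfin, hμF⟩ := artinReciprocity_character_holds F₀ (quadraticArtinChar F₀ F hdeg)
    have hKae := eventually_valueAtUniformizer_eq_quadraticSign h2K hμK
    have hFae := eventually_valueAtUniformizer_eq_quadraticSign hdeg hμF
    refine ⟨μK, μF, ⟨hKfin, ?_⟩, ⟨hFfin, ?_⟩, ⟨?_, ?_⟩, fun v ↦ ?_, fun w ↦ ?_⟩
    · filter_upwards [eventually_muHyp_clause h2K hKae] with v hv
      exact ⟨hv.1, hv.2.1, fun hK _ ↦ hv.2.2 hK⟩
    · filter_upwards [eventually_muHyp_clause hdeg hFae] with v hv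
      exact ⟨hv.1, hv.2.1, fun _ hF ↦ hv.2.2 hF⟩
    · exact (Commute.all μK μF).isOfFinOrder_mul hKfin hFfin
    · filter_upwards [eventually_muHyp_clause h2K hKae, eventually_muHyp_clause hdeg hFae] with v
        hvK hvF
      refine ⟨parity_isUnramifiedAt_mul hvK.1 hvF.1, ?_, fun hK hF ↦ ?_⟩
      · rw [parity_valueAtUniformizer_mul, mul_pow, hvK.2.1, hvF.2.1, one_mul]
      · rw [parity_valueAtUniformizer_mul, hvK.2.2 hK, hvF.2.2 hF, one_mul]
    · -- `μK,v(-1) = -1`: `K` is totally complex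
      exact archComponent_neg_one_eq_neg_one_of_forall_not_isReal hCFT h2K hμK (hTR.isReal v)
        fun u _ hu ↦ InfinitePlace.not_isReal_iff_isComplex.mpr (IsTotallyComplex.isComplex u) hu
    · by_cases hw : w.IsReal
      · -- real `w`: the complex conjugation `res c_w` lies in `res(Γ_F)`
        rw [if_pos hw]
        obtain ⟨c, hc⟩ := exists_isComplexConjugation (InfinitePlace.embedding_of_isReal hw)
        have hv : (w.comap (algebraMap F₀ F)).IsReal := hw.comap _
        have hc₀ : IsComplexConjugationAt hv (absGaloisRestrict F₀ F c) := by
          change IsComplexConjugation _ _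
          rw [embedding_of_isReal_comap hw hv]
          exact isComplexConjugation_absGaloisRestrict hc
        have hmem : absGaloisRestrict F₀ F c ∈ (absGaloisRestrict F₀ F).range := ⟨c, rfl⟩
        rw [hCFT F₀ (quadraticArtinChar F₀ F hdeg) μF hμF _ hv _ hc₀,
          (quadraticArtinChar_apply_eq_one_iff hdeg (absGaloisRestrict F₀ F c)).mpr hmem, map_one]
      · -- complex `w`: no real place of `F` above `v`
        rw [if_neg hw]
        refine archComponent_neg_one_eq_neg_one_of_forall_not_isReal hCFT hdeg hμF (hTR.isReal _)
          fun w' hw'v hw' ↦ hw ?_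
        rcases (comap_eq_comap_iff hτ).mp hw'v with rfl | rfl
        · exact hw'
        · exact InfinitePlace.isReal_smul_iff.mp hw'

end Summit.Langlands.Langlands.Theorems.HostInducedRep.OneTransparentPane

end
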